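import Summits.QuantumFields.YangMills.Theorems.FluctuationComparisonRegPrIntLS2BetaJacPi
import Literature.MathematicalPhysics.QuantumFieldTheory.Balaban1983to89.HaarExponentialChartMeasure
import Mathlib.Analysis.SpecialFunctions.Trigonometric.Sinc
import HarnessLib

/-!
# (JAC-Π) FOR `SU(2)` IN CLOSED FORM: `|det jac_{𝔰𝔲(2)^B}(X)| = Π_b sinc²‖X_b‖`, hence the transversal density of the docked tubular chart is
# `jV y = σ₀ · Π_b sinc²‖(eV y)_b‖` — the letter behind px21's verb-#2 gate word (★★OWNER WORD 77 (d) ∕ 78 (A)) as a TREE LEMMA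

Crux `stmt-QuantumFields-20520` (`…Theses.UnitScaleTilt.FluctuationComparisonRegPrIntL`), LINE g18-1 S2β, organ DET-REP-B‴ (seam `log det M_y − 2·log jV`);
cell `ym3-torus` (HUMAN RULING D-0037 — YM₃ on T³ is ladder rung R3; NOT d = 4, NOT infinite volume, NOT a mass gap, NOT the Clay problem), width seat
`ym3-torus-px21` g12; count-neutral helper (`--kind proof --supports stmt-QuantumFields-20520 --as helper`).  Theorems only: 0 `def`, 0 `instance`, 0 `notation`, 0 `sorry`.

WHAT.
* §1 `star_su2Coord_mul_self`, `norm_su2Coord_eq_sqrt` — `X(A)ᴴX(A) = |A|²·1`, `‖X(A)‖ = √(A·A)` (C⋆-identity);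
  ★`det_jac_su2_eq_sinc_sq (X : (specialUnitaryLogChart (Fin 2)).lie) : det jac(X) = sinc²‖X‖` — lit ✓`B13HaarSigmaJacobian.det_jac_su2_real` (`A ≠ 0`:
  `(sin|A|∕|A|)²`) and ✓`jac_zero` (`A = 0`) read through `su2Equiv` on the cell's log-chart carrier (`(specialUnitaryLogChart (Fin 2)).lie` IS B13's
  `(su (Fin 2)).toSubmodule`, definitionally), with Mathlib's `Real.sinc` (`sinc 0 = 1`).
* §2 ★★`abs_det_jac_pi_su2_eq_prod_sinc_sq (X : (piLogChart (specialUnitaryLogChart (Fin 2)) B).lie) : |det jac_{𝔤^B}(X)| = Π_b sinc²‖X_b‖` —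
  ✓`…S2BetaJacPi.abs_det_jac_pi` ((JAC-Π), px21 g11) + §1 bond by bond; `det_jac_pi_su2_pos`: the determinant is `> 0` once every `‖X_b‖ < π`.
* §3 ★★`transversalDensity_eq_prod_sinc_sq` — the (F4b′) row of ✓`…TubularChartDockLocal.exists_tubularHaarChart_pivotAct_local` (conjunct
  `∃ σ₀ > 0, ∀ y, jV y = σ₀·|det jac_{𝔰𝔲(2)^{free}}(eV y)|`) REWRITTEN: `∃ σ₀ > 0, ∀ y, jV y = σ₀ · Π_b sinc²‖(eV y)_b‖` — for ANY index type of free bonds and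
  ANY frame `eV` (a hypothesis-to-conclusion door; instantiate with E3″'s conjunct 25).  So `log jV y = log σ₀ + 2·Σ_b log sinc‖(eV y)_b‖`: a corner-independent
  constant plus a BONDWISE-LOCAL, even, real-analytic function of the `Ad`-invariant lengths `‖(eV y)_b‖` — the facts used in the gate words of 02:03:19Z ∕ 02:19:49Z.
HONEST SCOPE.  Linear algebra ∕ special functions over landed letters; nothing of Bałaban's analysis; DETN ∕ JACW ∕ DET-REP-B‴ ∕ FOUR-POINT-DECAY ∕ S2β ∕ the crux
20520 are NOT proved; rung R3 = YM₃ on T³ — NOT d = 4, NOT infinite volume, NOT a mass gap, NOT Clay; the Yang–Mills mass gap is NOT proved.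
[cite: Helgason2000, Ch. I §1 Thm 1.14 (12)-(13) p.96; Balaban1985UV3, (18) p.260]
-/

set_option autoImplicit false
noncomputable section

open NormedSpace
open Literature.MathematicalPhysics.QuantumFieldTheory.Balaban1983to89
open Literature.MathematicalPhysics.QuantumFieldTheory.Balaban1983to89.LogChartProduct
open Literature.MathematicalPhysics.QuantumFieldTheory.Balaban1983to89.HaarExponentialChart
open Literature.MathematicalPhysics.QuantumFieldTheory.Balaban1983to89.B13HaarSigmaJacobian
open Literature.MathematicalPhysics.QuantumFieldTheory.Balaban1983to89.B10Eq18SigmaSU2 (su2Coord)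
open Literature.Algebra.Lie.CompactKillingForm (su)
open scoped Matrix.Norms.L2Operator

namespace Summit.QuantumFields.YangMills.Theorems.FluctuationComparisonRegPrIntLS2BetaJacPiSinc

/-! ## §1 One bond: `det jac_{𝔰𝔲(2)}(X) = sinc²‖X‖` -/

/-- `X(A)ᴴ·X(A) = |A|²·1` for `X(A) = i·Σ_a A^a σ_a` (the Pauli matrices anticommute and square to `1`). [cite: Balaban1985UV3, p.260] -/
theorem star_su2Coord_mul_self (A : Fin 3 → ℝ) :
    star (su2Coord A) * su2Coord A = ((dotProduct A A : ℝ) : ℂ) • (1 : Matrix (Fin 2) (Fin 2) ℂ) := by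
  ext i j
  rw [Matrix.star_eq_conjTranspose]
  fin_cases i <;> fin_cases j <;>
    simp [su2Coord, Matrix.mul_apply, Fin.sum_univ_two, Fin.sum_univ_three, dotProduct, Matrix.conjTranspose_apply,
      Complex.ext_iff, Complex.mul_re, Complex.mul_im, Complex.add_re, Complex.add_im] <;>
    (try (constructor <;> ring))

/-- The L²-operator norm of `i·Σ_a A^a σ_a` is the Euclidean length `√(A·A)` of its Pauli coordinates (C⋆-identity `‖X‖² = ‖XᴴX‖ = |A|²`; same statement as
lit `B10Eq18SigmaSU2Window.norm_su2Coord`, re-derived here to keep the import cone inside the built tree). [cite: Balaban1985UV3, p.260] -/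
theorem norm_su2Coord_eq_sqrt (A : Fin 3 → ℝ) : ‖su2Coord A‖ = Real.sqrt (dotProduct A A) := by
  have hAA : 0 ≤ dotProduct A A := dotProduct_self_star_nonneg A
  have hsq : ‖su2Coord A‖ * ‖su2Coord A‖ = dotProduct A A := by
    rw [← CStarRing.norm_star_mul_self, star_su2Coord_mul_self, norm_smul, CStarRing.norm_one, mul_one, Complex.norm_real,
      Real.norm_eq_abs, abs_of_nonneg hAA]
  rw [← Real.sqrt_mul_self (norm_nonneg (su2Coord A)), hsq]

/-- ★ **`det jac_{𝔰𝔲(2)}(X) = sinc²‖X‖`** on the cell's log-chart carrier `(specialUnitaryLogChart (Fin 2)).lie` (which IS B13's `𝔰𝔲(2)` submodule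
definitionally): lit ✓`det_jac_su2_real` for `X ≠ 0` (`(sin|A|∕|A|)²`, `|A| = ‖X‖` by `norm_su2Coord_eq_sqrt`) and ✓`jac_zero` for `X = 0` (`sinc 0 = 1`); B13's
`Matrix.Norms.Operator`-scoped `jac` and the chart files' `Matrix.Norms.L2Operator`-scoped `jac` are the same operator (the two norms carry one topology, `rfl`).
[cite: Helgason2000, Ch. I §1 Thm 1.14 (12) p.96; Balaban1985UV3, (18) p.260] -/
theorem det_jac_su2_eq_sinc_sq (X : (specialUnitaryLogChart (Fin 2)).lie) :
    LinearMap.det (jac (lie_adStable_specialUnitaryGroup (n := Fin 2)) X :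
        (specialUnitaryLogChart (Fin 2)).lie →ₗ[ℝ] (specialUnitaryLogChart (Fin 2)).lie) =
      Real.sinc ‖(X : Matrix (Fin 2) (Fin 2) ℂ)‖ ^ 2 := by
  letI : LieRing (Matrix (Fin 2) (Fin 2) ℂ) := LieRing.ofAssociativeRing
  letI : LieAlgebra ℝ (Matrix (Fin 2) (Fin 2) ℂ) := LieAlgebra.ofAssociativeAlgebra
  -- B13's letter on its carrier `𝔰𝔲(2)`, read in Pauli coordinates
  have key : ∀ Y : (su (Fin 2)).toSubmodule,
      LinearMap.det (jac hlie_su2 Y : (su (Fin 2)).toSubmodule →ₗ[ℝ] (su (Fin 2)).toSubmodule) = Real.sinc ‖(Y : Matrix (Fin 2) (Fin 2) ℂ)‖ ^ 2 := by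
    intro Y
    obtain ⟨A, rfl⟩ : ∃ A : Fin 3 → ℝ, su2Equiv A = Y := ⟨su2Equiv.symm Y, su2Equiv.apply_symm_apply Y⟩
    by_cases hA : A = 0
    · subst hA
      rw [map_zero, jac_zero, ZeroMemClass.coe_zero, norm_zero, Real.sinc_zero, one_pow]
      simp
    · have hr : Real.sqrt (dotProduct A A) ≠ 0 := by
        rw [Real.sqrt_ne_zero']
        exact lt_of_le_of_ne (dotProduct_self_star_nonneg A) fun h => hA (dotProduct_self_eq_zero.mp h.symm)
      rw [su2Equiv_apply_coe, norm_su2Coord_eq_sqrt, Real.sinc_of_ne_zero hr]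
      convert det_jac_su2_real hA using 2
      -- the two `jac`s differ only in the (scoped) matrix norm instance feeding `→L`; the topologies agree definitionally
      rfl
  exact key X

/-- `det jac_{𝔰𝔲(2)}(X) > 0` whenever `‖X‖ < π` (lit ✓`det_jac_su2_pos` on the cell's carrier). [cite: Balaban1985UV3, (18) p.260] -/
theorem det_jac_su2_pos_of_norm_lt_pi (X : (specialUnitaryLogChart (Fin 2)).lie) (hX : ‖(X : Matrix (Fin 2) (Fin 2) ℂ)‖ < Real.pi) :
    0 < LinearMap.det (jac (lie_adStable_specialUnitaryGroup (n := Fin 2)) X :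
        (specialUnitaryLogChart (Fin 2)).lie →ₗ[ℝ] (specialUnitaryLogChart (Fin 2)).lie) := by
  rw [det_jac_su2_eq_sinc_sq]
  have h0 : 0 ≤ ‖(X : Matrix (Fin 2) (Fin 2) ℂ)‖ := norm_nonneg _
  refine pow_pos ?_ 2
  by_cases hz : ‖(X : Matrix (Fin 2) (Fin 2) ℂ)‖ = 0
  · rw [hz, Real.sinc_zero]; exact one_pos
  · rw [Real.sinc_of_ne_zero hz]
    exact div_pos (Real.sin_pos_of_pos_of_lt_pi (lt_of_le_of_ne h0 (Ne.symm hz)) hX) (lt_of_le_of_ne h0 (Ne.symm hz))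

/-! ## §2 The product chart: `|det jac_{𝔰𝔲(2)^B}(X)| = Π_b sinc²‖X_b‖` -/

section Pi

variable (B : Type*) [Fintype B] [FiniteDimensional ℝ (piLogChart (specialUnitaryLogChart (Fin 2)) B).lie]

/-- ★★ **(JAC-Π) FOR `SU(2)` IN CLOSED FORM**: `|det jac_{𝔰𝔲(2)^B}(X)| = Π_b sinc²‖X_b‖` (✓`abs_det_jac_pi` bond by bond through §1; `sinc² ≥ 0` drops the
absolute values). [cite: Helgason2000, Ch. I §1 Thm 1.14 (12)-(13) p.96; Balaban1985UV3, (18) p.260] -/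
theorem abs_det_jac_pi_su2_eq_prod_sinc_sq (X : (piLogChart (specialUnitaryLogChart (Fin 2)) B).lie) :
    |LinearMap.det (jac (lie_adStable_pi (specialUnitaryLogChart (Fin 2)) B (lie_adStable_specialUnitaryGroup (n := Fin 2))) X :
        (piLogChart (specialUnitaryLogChart (Fin 2)) B).lie →ₗ[ℝ] (piLogChart (specialUnitaryLogChart (Fin 2)) B).lie)| =
      ∏ b : B, Real.sinc ‖((X : (piLogChart (specialUnitaryLogChart (Fin 2)) B).lie) : B → Matrix (Fin 2) (Fin 2) ℂ) b‖ ^ 2 := by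
  rw [Summit.QuantumFields.YangMills.Theorems.FluctuationComparisonRegPrIntLS2BetaJacPi.abs_det_jac_pi
    (specialUnitaryLogChart (Fin 2)) (lie_adStable_specialUnitaryGroup (n := Fin 2)) B X]
  refine Finset.prod_congr rfl fun b _ => ?_
  rw [det_jac_su2_eq_sinc_sq, abs_of_nonneg (sq_nonneg _), coe_lieApply]

/-- The product Jacobian is POSITIVE once every bond coordinate is shorter than `π` (so the absolute value of (F4b′) is cosmetic on the small window).
[cite: Helgason2000, Ch. I §1 Thm 1.14 (12)-(13) p.96] -/
theorem det_jac_pi_su2_pos (X : (piLogChart (specialUnitaryLogChart (Fin 2)) B).lie)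
    (hX : ∀ b : B, ‖((X : (piLogChart (specialUnitaryLogChart (Fin 2)) B).lie) : B → Matrix (Fin 2) (Fin 2) ℂ) b‖ < Real.pi) :
    0 < LinearMap.det (jac (lie_adStable_pi (specialUnitaryLogChart (Fin 2)) B (lie_adStable_specialUnitaryGroup (n := Fin 2))) X :
        (piLogChart (specialUnitaryLogChart (Fin 2)) B).lie →ₗ[ℝ] (piLogChart (specialUnitaryLogChart (Fin 2)) B).lie) := by
  rw [Summit.QuantumFields.YangMills.Theorems.FluctuationComparisonRegPrIntLS2BetaJacPi.det_jac_pi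
    (specialUnitaryLogChart (Fin 2)) (lie_adStable_specialUnitaryGroup (n := Fin 2)) B X]
  refine Finset.prod_pos fun b _ => ?_
  have h := det_jac_su2_pos_of_norm_lt_pi (lieApply (specialUnitaryLogChart (Fin 2)) B X b) (by rw [coe_lieApply]; exact hX b)
  exact h

end Pi

/-! ## §3 The transversal density of the docked tubular chart: `jV = σ₀ · Π_b sinc²‖(eV y)_b‖` -/

section Transversal

variable {B : Type*} [Fintype B] [FiniteDimensional ℝ (piLogChart (specialUnitaryLogChart (Fin 2)) B).lie]
variable {V : Type*} (eV : V → (piLogChart (specialUnitaryLogChart (Fin 2)) B).lie) (jV : V → ℝ)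

/-- ★★ **THE (F4b′) ROW IN CLOSED FORM** — a hypothesis-to-conclusion door for the conjunct `∃ σ₀ > 0, ∀ y, jV y = σ₀·|det jac_{𝔰𝔲(2)^B}(eV y)|` of
✓`…TubularChartDockLocal.exists_tubularHaarChart_pivotAct_local` (E3″; any free-bond index type `B`, any frame `eV`): `jV y = σ₀ · Π_b sinc²‖(eV y)_b‖` with the
SAME `σ₀`.  Consequently `log jV` is a corner-independent constant plus the bondwise-local `2·Σ_b log sinc‖(eV y)_b‖`; `σ₀` cancels in every mixed second
difference of `log jV` (DET-REP-B‴'s VALUE-form seam). [cite: Helgason2000, Ch. I §1 Thm 1.14 (13) p.96; Balaban1985UV3, (18) p.260] -/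
theorem transversalDensity_eq_prod_sinc_sq
    (hF4b : ∃ σ₀ : ℝ, 0 < σ₀ ∧ ∀ y, jV y = σ₀ * |LinearMap.det
      (jac (lie_adStable_pi (specialUnitaryLogChart (Fin 2)) B (lie_adStable_specialUnitaryGroup (n := Fin 2))) (eV y) :
        (piLogChart (specialUnitaryLogChart (Fin 2)) B).lie →ₗ[ℝ] (piLogChart (specialUnitaryLogChart (Fin 2)) B).lie)|) :
    ∃ σ₀ : ℝ, 0 < σ₀ ∧ ∀ y, jV y =
      σ₀ * ∏ b : B, Real.sinc ‖((eV y : (piLogChart (specialUnitaryLogChart (Fin 2)) B).lie) : B → Matrix (Fin 2) (Fin 2) ℂ) b‖ ^ 2 := by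
  obtain ⟨σ₀, hσ₀, h⟩ := hF4b
  exact ⟨σ₀, hσ₀, fun y => by rw [h y, abs_det_jac_pi_su2_eq_prod_sinc_sq B (eV y)]⟩

/-- **`log jV` IS A CONSTANT PLUS A BONDWISE SUM** on the part of the frame where every coordinate is shorter than `π` (each factor positive):
`log jV y = log σ₀ + Σ_b log (sinc²‖(eV y)_b‖)`. [cite: Helgason2000, Ch. I §1 Thm 1.14 (13) p.96] -/
theorem log_transversalDensity_eq
    (hF4b : ∃ σ₀ : ℝ, 0 < σ₀ ∧ ∀ y, jV y = σ₀ * |LinearMap.det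
      (jac (lie_adStable_pi (specialUnitaryLogChart (Fin 2)) B (lie_adStable_specialUnitaryGroup (n := Fin 2))) (eV y) :
        (piLogChart (specialUnitaryLogChart (Fin 2)) B).lie →ₗ[ℝ] (piLogChart (specialUnitaryLogChart (Fin 2)) B).lie)|) :
    ∃ σ₀ : ℝ, 0 < σ₀ ∧ ∀ y, (∀ b : B, ‖((eV y : (piLogChart (specialUnitaryLogChart (Fin 2)) B).lie) : B → Matrix (Fin 2) (Fin 2) ℂ) b‖ < Real.pi) →
      Real.log (jV y) = Real.log σ₀ +
        ∑ b : B, Real.log (Real.sinc ‖((eV y : (piLogChart (specialUnitaryLogChart (Fin 2)) B).lie) : B → Matrix (Fin 2) (Fin 2) ℂ) b‖ ^ 2) := by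
  obtain ⟨σ₀, hσ₀, h⟩ := transversalDensity_eq_prod_sinc_sq eV jV hF4b
  refine ⟨σ₀, hσ₀, fun y hy => ?_⟩
  have hpos : ∀ b ∈ (Finset.univ : Finset B),
      0 < Real.sinc ‖((eV y : (piLogChart (specialUnitaryLogChart (Fin 2)) B).lie) : B → Matrix (Fin 2) (Fin 2) ℂ) b‖ ^ 2 := by
    intro b _
    have hb := hy b
    set r := ‖((eV y : (piLogChart (specialUnitaryLogChart (Fin 2)) B).lie) : B → Matrix (Fin 2) (Fin 2) ℂ) b‖ with hr
    have hr0 : 0 ≤ r := norm_nonneg _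
    refine pow_pos ?_ 2
    by_cases h0 : r = 0
    · rw [h0, Real.sinc_zero]; exact one_pos
    · rw [Real.sinc_of_ne_zero h0]
      exact div_pos (Real.sin_pos_of_pos_of_lt_pi (lt_of_le_of_ne hr0 (Ne.symm h0)) hb) (lt_of_le_of_ne hr0 (Ne.symm h0))
  rw [h y, Real.log_mul hσ₀.ne' (Finset.prod_pos hpos).ne', Real.log_prod fun b hb => (hpos b hb).ne']

end Transversal

end Summit.QuantumFields.YangMills.Theorems.FluctuationComparisonRegPrIntLS2BetaJacPiSinc

end
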